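import Literature.NumberTheory.NumberFields.EisensteinFieldIntegers
import Literature.NumberTheory.NumberFields.SelmerGroupPID
import Mathlib.RingTheory.DedekindDomain.AdicValuation
import Mathlib.Data.Nat.Factorization.Basic
import HarnessLib

/-!
# The Eisenstein field at an inert prime: valuation, residue map, cubic residue character

Topic `NumberTheory/NumberFields`. Local arithmetic of `K3 = ℚ(ζ₃)` (`EisensteinField.lean`,
`EisensteinFieldIntegers.lean`) at a rational prime `p` that stays prime in `𝓞 K3 = ℤ[ζ₃]`
(`p ≡ 2 (mod 3)`; we need `p = 2, 5`), in COORDINATES `x = a + bζ`, for the local conditions of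
the `√−3`-descent on `y² = x³ + (2^a 5^b)²`
(`Literature/Barriers/BirchSwinnertonDyer/RankNotSumOfLocalInvariantsCubicTwists.lean`):

* `K3.val hq` — the `q`-adic valuation of `K3` at a prime element `q ∈ 𝓞 K3` (Mathlib's
  `IsDedekindDomain.HeightOneSpectrum.valuation` at the place `(q)`), with `val q = exp(−1)`,
  `val = 1` on integers prime to `q`, `val ≤ exp(−n) ↔ qⁿ ∣ ·` on `𝓞 K3`;
* for a rational prime `p` prime in `𝓞 K3`: every `x` with `val x ≤ 1` is `x = (a + bζ)/c` with
  `p ∤ c` (`exists_rep_of_val_le_one`); the residue map `K3.red p : K3 → 𝔽_{p²}`,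
  `𝔽_{p²} = QuadraticAlgebra (ZMod p) (-1) (-1) = 𝔽_p[ω]/(ω² + ω + 1)`, by `Rat.cast` on the
  coordinates — additive and multiplicative on `p`-integral elements, zero exactly on
  `{val < 1}` (`red_eq_zero_of_val_lt_one`, `red_ne_zero_of_val_eq_one`);
* the unit part `K3.unitPart p x = x · p^{log val x}` (a `val`-unit) and the **cubic residue
  character of the unit part** `K3.chi p x = χ̄(red (unitPart x)) ∈ ℤ/3ℤ`, where
  `χ̄ = K3.cubicChar : 𝔽_{p²} → ℤ/3ℤ` is the discrete logarithm of `z^{(p² − 1)/3} ∈ {1, ω̄, ω̄²}`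
  (Ireland–Rosen Ch. 9 §3, the cubic residue character; here only as a function whose
  multiplicativity on `𝔽_{p²}ˣ` and triviality on `𝔽_pˣ` are finite checks, done by `decide` for
  `p = 2, 5`);
* granted those two finite checks: `chi (x y) = chi x + chi y` (`chi_mul`),
  `val (y − x) < val x ⟹ chi y = chi x` (`chi_eq_of_val_sub_lt`), `chi q = 0` for `q ∈ ℚˣ`
  (`chi_ratCast`), `chi ζ = χ̄(ω̄)` — the axioms `MordellDescent.IsResidueChar` of
  `Literature/NumberTheory/EllipticCurves/MordellCurveCubicDescentLocal.lean`;
* the instances `p = 2` (`𝔽₄`, `chi2`, `χ̄(ω̄) = 1`) and `p = 5` (`𝔽₂₅`, `chi5`, `χ̄(ω̄) = 2`), and the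
  valuations of `ζ, ζ − 1, 2, 5` at `2`, `5` and `λ = ζ − 1`.

## References

* K. Ireland, M. Rosen, *A Classical Introduction to Modern Number Theory*, 2nd ed., GTM 84
  (1990), Ch. 9 §1 (`ℤ[ω]`, inert primes `p ≡ 2 (mod 3)` with residue field of order `p²`),
  §3 (the cubic residue character `α^{(Nπ − 1)/3} ≡ ω^i (mod π)`). [IrelandRosen1990]
* J. H. Silverman, *The Arithmetic of Elliptic Curves*, 2nd ed., GTM 106 (2009), X.1, X.4
  (local images of descent maps). [SilvermanAEC2009]
-/

noncomputable section

open QuadraticAlgebra NumberField IsDedekindDomain IsDedekindDomain.HeightOneSpectrum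
open WithZero (log exp)
open scoped WithZero

namespace Literature.NumberTheory.NumberFields

namespace K3

/-! ### The valuation at a prime element of `𝓞 K3` -/

section Place

variable {q : 𝓞 K3} (hq : Prime q)

/-- **The `q`-adic valuation of `K3`** at a prime element `q` (the adic valuation of the place
`(q)`). [folklore] -/
abbrev val (hq : Prime q) : Valuation K3 ℤᵐ⁰ := (placeOfPrime hq).valuation K3

/-- On integers `val` is the integral valuation. [folklore] -/
theorem val_coe (y : 𝓞 K3) : val hq (y : K3) = (placeOfPrime hq).intValuation y :=
  valuation_of_algebraMap _ y

/-- `val q = exp(−1)`. [folklore] -/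
theorem val_self : val hq (q : K3) = exp (-1) := by
  rw [val_coe, intValuation_singleton _ hq.ne_zero rfl]

/-- `log val q = −1`. [folklore] -/
theorem log_val_self : log (val hq (q : K3)) = -1 := by rw [val_self, WithZero.log_exp]

/-- Integers have `val ≤ 1`. [folklore] -/
theorem val_coe_le_one (y : 𝓞 K3) : val hq (y : K3) ≤ 1 := valuation_le_one _ y

/-- `val y = 1 ↔ q ∤ y` for an integer `y`. [folklore] -/
theorem val_coe_eq_one_iff (y : 𝓞 K3) : val hq (y : K3) = 1 ↔ ¬ q ∣ y := by
  rw [val_coe, intValuation_eq_one_iff]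
  change y ∉ Ideal.span {q} ↔ _
  rw [Ideal.mem_span_singleton]

/-- `val y < 1 ↔ q ∣ y` for an integer `y`. [folklore] -/
theorem val_coe_lt_one_iff (y : 𝓞 K3) : val hq (y : K3) < 1 ↔ q ∣ y := by
  rw [← not_iff_not, not_lt, ← val_coe_eq_one_iff hq]
  exact ⟨fun h ↦ le_antisymm (val_coe_le_one hq y) h, fun h ↦ h.ge⟩

/-- `val y ≤ exp(−n) → qⁿ ∣ y` for an integer `y`. [folklore] -/
theorem pow_dvd_of_val_coe_le {y : 𝓞 K3} {n : ℕ} (h : val hq (y : K3) ≤ exp (-(n : ℤ))) :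
    q ^ n ∣ y := by
  rw [val_coe] at h
  have hmem := (intValuation_le_pow_iff_mem _ y n).mp h
  change y ∈ Ideal.span {q} ^ n at hmem
  rwa [Ideal.span_singleton_pow, Ideal.mem_span_singleton] at hmem

/-- Units of `𝓞 K3` have `val = 1`. [folklore] -/
theorem val_coe_unit (u : (𝓞 K3)ˣ) : val hq ((u : 𝓞 K3) : K3) = 1 :=
  (val_coe_eq_one_iff hq _).mpr fun h ↦ hq.not_unit (isUnit_of_dvd_unit h u.isUnit)

/-- `log val u = 0` for a unit. [folklore] -/
theorem log_val_coe_unit (u : (𝓞 K3)ˣ) : log (val hq ((u : 𝓞 K3) : K3)) = 0 := by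
  rw [val_coe_unit, WithZero.log_one]

/-- `val ζ = 1`. [folklore] -/
theorem val_zeta : val hq zeta = 1 := by
  rw [← coe_zetaInt, val_coe_eq_one_iff]
  exact fun h ↦ hq.not_unit (isUnit_of_dvd_unit h
    (isPrimitiveRoot_zeta.toInteger_isPrimitiveRoot.isUnit (by norm_num)))

/-- `log val ζ = 0`. [folklore] -/
theorem log_val_zeta : log (val hq zeta) = 0 := by rw [val_zeta, WithZero.log_one]

/-- `val (−1) = 1`, `log = 0`. [folklore] -/
theorem log_val_neg_one : log (val hq (-1)) = 0 := by rw [Valuation.map_neg, Valuation.map_one, WithZero.log_one]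

/-- `log val (±1) = 0`. [folklore] -/
theorem log_val_sign {s : ℤ} (hs : s = 1 ∨ s = -1) : log (val hq (s : K3)) = 0 := by
  rcases hs with rfl | rfl
  · rw [Int.cast_one, Valuation.map_one, WithZero.log_one]
  · rw [Int.cast_neg, Int.cast_one]; exact log_val_neg_one hq

/-- `val (s) = 1` for `s = ±1`. [folklore] -/
theorem val_sign {s : ℤ} (hs : s = 1 ∨ s = -1) : val hq (s : K3) = 1 := by
  rcases hs with rfl | rfl
  · rw [Int.cast_one, Valuation.map_one]
  · rw [Int.cast_neg, Int.cast_one, Valuation.map_neg, Valuation.map_one]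

/-- An integer `a + bζ` not divisible by `q` has `val = 1`. [folklore] -/
theorem val_mkInt_eq_one {a b : ℤ} (h : ¬ q ∣ mkInt a b) : val hq (⟨a, b⟩ : K3) = 1 := by
  rw [← coe_mkInt, val_coe_eq_one_iff]; exact h

end Place

/-! ### Generic finite places: units have valuation one -/

section AnyPlace

variable (v : HeightOneSpectrum (𝓞 K3))

/-- `v(y) = 1` for an integer `y ∉ v`. [folklore] -/
theorem valuation_coe_eq_one {y : 𝓞 K3} (hy : y ∉ v.asIdeal) : v.valuation K3 (y : K3) = 1 := by
  rw [valuation_of_algebraMap, intValuation_eq_one_iff]; exact hy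

/-- If `D ∉ v` and `y ∣ D` then `v(y) = 1`. [folklore] -/
theorem valuation_coe_eq_one_of_dvd {y D : 𝓞 K3} (hD : D ∉ v.asIdeal) (hy : y ∣ D) :
    v.valuation K3 (y : K3) = 1 :=
  valuation_coe_eq_one v fun h ↦ hD (Ideal.mem_of_dvd _ hy h)

/-- At a place not above `30`: `v(2) = v(5) = 1`. [folklore] -/
theorem valuation_two_five_of_thirty {v : HeightOneSpectrum (𝓞 K3)} (hv : (30 : 𝓞 K3) ∉ v.asIdeal) :
    v.valuation K3 2 = 1 ∧ v.valuation K3 5 = 1 := by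
  exact ⟨valuation_coe_eq_one_of_dvd v hv (y := 2) ⟨15, by norm_num⟩,
    valuation_coe_eq_one_of_dvd v hv (y := 5) ⟨6, by norm_num⟩⟩

/-- At a place not above `30`: `v(2 · 2^a 5^b) = 1`, i.e. `log = 0`. [folklore] -/
theorem log_valuation_two_mul_eq_zero {v : HeightOneSpectrum (𝓞 K3)} (hv : (30 : 𝓞 K3) ∉ v.asIdeal)
    (a b : ℕ) : log (v.valuation K3 (2 * ((2 ^ a * 5 ^ b : ℕ) : K3))) = 0 := by
  obtain ⟨h2, h5⟩ := valuation_two_five_of_thirty hv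
  push_cast
  rw [Valuation.map_mul, Valuation.map_mul, Valuation.map_pow, Valuation.map_pow, h2, h5, one_pow,
    one_pow, one_mul, one_mul, WithZero.log_one]

end AnyPlace

/-! ### Inert rational primes: `p`-integral elements in coordinates -/

section Inert

variable {p : ℕ} [hpp : Fact p.Prime] (hp : Prime ((p : ℕ) : 𝓞 K3))

/-- `(p : 𝓞 K3) = (p : K3)`. [folklore] -/
theorem coe_natCast_ringOfIntegers (n : ℕ) : ((n : 𝓞 K3) : K3) = (n : K3) := by push_cast; rfl

omit hpp in
/-- `val p = exp(−1)` for the valuation at `p`. [folklore] -/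
theorem val_natCast_self : val hp (p : K3) = exp (-1) := by
  rw [← coe_natCast_ringOfIntegers, val_self]

omit hpp in
/-- `log val p = −1`. [folklore] -/
theorem log_val_natCast_self : log (val hp (p : K3)) = -1 := by
  rw [val_natCast_self, WithZero.log_exp]

/-- `(p : K3) ≠ 0`. [folklore] -/
theorem natCast_ne_zero : (p : K3) ≠ 0 := by exact_mod_cast hpp.out.ne_zero

omit hpp in
/-- `p ∣ mkInt a b ↔ p ∣ a ∧ p ∣ b` for a natural `p`. [folklore] -/
theorem natCast_dvd_mkInt_iff (p : ℕ) (a b : ℤ) :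
    ((p : ℕ) : 𝓞 K3) ∣ mkInt a b ↔ (p : ℤ) ∣ a ∧ (p : ℤ) ∣ b := by
  rw [← intCast_dvd_mkInt_iff, Int.cast_natCast]

omit hpp in
/-- An integer `c` prime to `p` has `val c = 1`. [folklore] -/
theorem val_intCast_of_not_dvd {c : ℤ} (hc : ¬ (p : ℤ) ∣ c) : val hp (c : K3) = 1 := by
  have h : (c : K3) = ((mkInt c 0 : 𝓞 K3) : K3) := by rw [coe_mkInt]; ext <;> simp
  rw [h, val_coe_eq_one_iff, natCast_dvd_mkInt_iff p]
  exact fun h' ↦ hc h'.1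

omit hpp in
/-- A natural `c` prime to `p` has `val c = 1`. [folklore] -/
theorem val_natCast_of_not_dvd {c : ℕ} (hc : ¬ p ∣ c) : val hp (c : K3) = 1 := by
  have := val_intCast_of_not_dvd hp (c := c) (by exact_mod_cast hc)
  simpa using this

omit hpp in
/-- `log val c = 0` for a natural `c` prime to `p`. [folklore] -/
theorem log_val_natCast_of_not_dvd {c : ℕ} (hc : ¬ p ∣ c) : log (val hp (c : K3)) = 0 := by
  rw [val_natCast_of_not_dvd hp hc, WithZero.log_one]

/-- Clearing denominators: `d · x` has integer coordinates for `d = den(re) · den(im)`.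
[folklore] -/
theorem den_mul_eq_mk (x : K3) :
    ((x.re.den * x.im.den : ℕ) : K3) * x =
      ⟨((x.re.num * x.im.den : ℤ) : ℚ), ((x.im.num * x.re.den : ℤ) : ℚ)⟩ := by
  have h1 : ((x.re.den * x.im.den : ℕ) : ℚ) * x.re = (x.re.num * x.im.den : ℤ) := by
    push_cast
    rw [show (x.re.den : ℚ) * x.im.den * x.re = (x.re * x.re.den) * x.im.den by ring,
      Rat.mul_den_eq_num]
  have h2 : ((x.re.den * x.im.den : ℕ) : ℚ) * x.im = (x.im.num * x.re.den : ℤ) := by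
    push_cast
    rw [show (x.re.den : ℚ) * x.im.den * x.im = (x.im * x.im.den) * x.re.den by ring,
      Rat.mul_den_eq_num]
  ext
  · simp only [re_mul, re_natCast, im_natCast, mul_zero, zero_mul, add_zero, h1]
  · simp only [im_mul, re_natCast, im_natCast, zero_mul, add_zero, mul_zero, h2]

/-- **`p`-integral elements in coordinates**: if `val_p x ≤ 1` then `c · x = a + bζ` for some
natural `c` prime to `p` and integers `a, b` (write a common denominator as `p^e c`; then
`p^e` divides the numerator in `𝓞 K3`). [cite: IrelandRosen1990, Ch. 9 §1] -/
theorem exists_rep_of_val_le_one {x : K3} (hx : val hp x ≤ 1) :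
    ∃ (c : ℕ) (a b : ℤ), ¬ p ∣ c ∧ (c : K3) * x = ⟨a, b⟩ := by
  set d : ℕ := x.re.den * x.im.den with hd
  have hd0 : d ≠ 0 := mul_ne_zero x.re.den_nz x.im.den_nz
  obtain ⟨e, c, hc, hdec⟩ := Nat.exists_eq_pow_mul_and_not_dvd hd0 p hpp.out.ne_one
  set A : ℤ := x.re.num * x.im.den
  set B : ℤ := x.im.num * x.re.den
  have hdx : (d : K3) * x = ((mkInt A B : 𝓞 K3) : K3) := by rw [coe_mkInt, hd, den_mul_eq_mk]
  -- valuation of the numerator `y = d x`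
  have hvy : val hp ((mkInt A B : 𝓞 K3) : K3) ≤ exp (-(e : ℤ)) := by
    rw [← hdx, hdec, Nat.cast_mul, Nat.cast_pow, Valuation.map_mul, Valuation.map_mul,
      Valuation.map_pow, val_natCast_self, val_natCast_of_not_dvd hp hc, ← WithZero.exp_nsmul,
      mul_one]
    simp only [smul_neg, nsmul_eq_mul, mul_one]
    exact mul_le_of_le_one_right' hx
  obtain ⟨y', hy'⟩ := pow_dvd_of_val_coe_le hp hvy
  obtain ⟨a, b, rfl⟩ := exists_eq_mkInt y'
  refine ⟨c, a, b, hc, ?_⟩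
  have hpe : ((p : K3) ^ e) ≠ 0 := pow_ne_zero e (natCast_ne_zero (p := p))
  have key : (p : K3) ^ e * ((c : K3) * x) = (p : K3) ^ e * ⟨a, b⟩ := by
    have h1 : (p : K3) ^ e * ((c : K3) * x) = (d : K3) * x := by
      rw [hdec]; push_cast; ring
    rw [h1, hdx, hy']
    push_cast
    rfl
  exact mul_left_cancel₀ hpe key

/-! ### The residue map `K3 → 𝔽_{p²}` on `p`-integral elements -/

/-- The residue ring `𝔽_p[ω]/(ω² + ω + 1)` (`= 𝔽_{p²}` for `p ≡ 2 (mod 3)`). [folklore] -/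
abbrev F (p : ℕ) : Type := QuadraticAlgebra (ZMod p) (-1) (-1)

/-- `𝔽_p[ω]` is finite (computably, for `decide`). [folklore] -/
instance instFintypeF (p : ℕ) [NeZero p] : Fintype (F p) :=
  Fintype.ofEquiv (ZMod p × ZMod p) (QuadraticAlgebra.equivProd (-1 : ZMod p) (-1)).symm

variable (p) in
/-- **The residue map** `x = a + bζ ↦ ā + b̄ω` on coordinates (`Rat.cast`; meaningful on
`p`-integral elements). [cite: IrelandRosen1990, Ch. 9 §1] -/
def red (x : K3) : F p := ⟨(x.re : ZMod p), (x.im : ZMod p)⟩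

/-- `(c : ZMod p) ≠ 0` for `p ∤ c`. [folklore] -/
theorem natCast_zmod_ne_zero {c : ℕ} (hc : ¬ p ∣ c) : (c : ZMod p) ≠ 0 := by
  rwa [Ne, ZMod.natCast_eq_zero_iff]

/-- The residue of a represented element: `c x = a + bζ`, `p ∤ c` ⟹ `c̄ • red x = ā + b̄ω`.
[folklore] -/
theorem smul_red_of_rep {x : K3} {c : ℕ} {a b : ℤ} (hc : ¬ p ∣ c) (h : (c : K3) * x = ⟨a, b⟩) :
    (c : ZMod p) • red p x = ⟨(a : ZMod p), (b : ZMod p)⟩ := by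
  have hc0 : (c : ℚ) ≠ 0 := by
    have : c ≠ 0 := fun h0 ↦ hc (h0 ▸ dvd_zero p)
    exact_mod_cast this
  have hcp : ((c : ℤ) : ZMod p) ≠ 0 := by rw [Int.cast_natCast]; exact natCast_zmod_ne_zero hc
  have hcp' : (c : ZMod p) ≠ 0 := natCast_zmod_ne_zero hc
  have hre : x.re = Rat.divInt a c := by
    have := congrArg QuadraticAlgebra.re h
    simp only [re_mul, re_natCast, im_natCast, mul_zero, zero_mul, add_zero] at this
    rw [Rat.divInt_eq_div]; push_cast; rw [eq_div_iff hc0]; linear_combination this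
  have him : x.im = Rat.divInt b c := by
    have := congrArg QuadraticAlgebra.im h
    simp only [im_mul, re_natCast, im_natCast, zero_mul, add_zero, mul_zero] at this
    rw [Rat.divInt_eq_div]; push_cast; rw [eq_div_iff hc0]; linear_combination this
  rw [red, hre, him, Rat.cast_divInt_of_ne_zero a hcp, Rat.cast_divInt_of_ne_zero b hcp]
  ext
  · simp only [re_smul, smul_eq_mul, Int.cast_natCast]; exact mul_div_cancel₀ _ hcp'
  · simp only [im_smul, smul_eq_mul, Int.cast_natCast]; exact mul_div_cancel₀ _ hcp'

/-- Reduction of integer coordinates is multiplicative. [folklore] -/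
theorem mk_intCast_mul (a b a' b' : ℤ) :
    (⟨((a * a' - b * b' : ℤ) : ZMod p), ((a * b' + b * a' - b * b' : ℤ) : ZMod p)⟩ : F p) =
      ⟨(a : ZMod p), (b : ZMod p)⟩ * ⟨(a' : ZMod p), (b' : ZMod p)⟩ := by
  ext
  · simp only [re_mul]; push_cast; ring
  · simp only [im_mul]; push_cast; ring

/-- **`red` is multiplicative on `p`-integral elements.** [folklore] -/
theorem red_mul {x y : K3} (hx : val hp x ≤ 1) (hy : val hp y ≤ 1) :
    red p (x * y) = red p x * red p y := by
  obtain ⟨c, a, b, hc, hcx⟩ := exists_rep_of_val_le_one hp hx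
  obtain ⟨c', a', b', hc', hcy⟩ := exists_rep_of_val_le_one hp hy
  have hcc : ¬ p ∣ c * c' := fun h ↦ (hpp.out.dvd_mul.mp h).elim hc hc'
  have hrep : ((c * c' : ℕ) : K3) * (x * y) =
      ⟨((a * a' - b * b' : ℤ) : ℚ), ((a * b' + b * a' - b * b' : ℤ) : ℚ)⟩ := by
    rw [show ((c * c' : ℕ) : K3) * (x * y) = ((c : K3) * x) * ((c' : K3) * y) by push_cast; ring,
      hcx, hcy]
    ext
    · simp only [re_mul]; push_cast; ring
    · simp only [im_mul]; push_cast; ring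
  have h1 := smul_red_of_rep (p := p) hcc hrep
  rw [mk_intCast_mul, ← smul_red_of_rep hc hcx, ← smul_red_of_rep hc' hcy, smul_mul_smul_comm,
    ← Nat.cast_mul] at h1
  exact smul_right_injective (F p) (natCast_zmod_ne_zero hcc) h1

/-- **`red` is additive on `p`-integral elements.** [folklore] -/
theorem red_add {x y : K3} (hx : val hp x ≤ 1) (hy : val hp y ≤ 1) :
    red p (x + y) = red p x + red p y := by
  obtain ⟨c, a, b, hc, hcx⟩ := exists_rep_of_val_le_one hp hx
  obtain ⟨c', a', b', hc', hcy⟩ := exists_rep_of_val_le_one hp hy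
  have hcc : ¬ p ∣ c * c' := fun h ↦ (hpp.out.dvd_mul.mp h).elim hc hc'
  have hrep : ((c * c' : ℕ) : K3) * (x + y) =
      ⟨((c' * a + c * a' : ℤ) : ℚ), ((c' * b + c * b' : ℤ) : ℚ)⟩ := by
    rw [show ((c * c' : ℕ) : K3) * (x + y) = (c' : K3) * ((c : K3) * x) + (c : K3) * ((c' : K3) * y) by
      push_cast; ring, hcx, hcy]
    ext
    · simp only [re_add, re_mul, re_natCast, im_natCast]; push_cast; ring
    · simp only [im_add, im_mul, re_natCast, im_natCast]; push_cast; ring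
  have h1 := smul_red_of_rep (p := p) hcc hrep
  have h2 : ((c * c' : ℕ) : ZMod p) • (red p x + red p y) =
      ⟨((c' * a + c * a' : ℤ) : ZMod p), ((c' * b + c * b' : ℤ) : ZMod p)⟩ := by
    rw [smul_add, show ((c * c' : ℕ) : ZMod p) • red p x = (c' : ZMod p) • ((c : ZMod p) • red p x) by
        rw [smul_smul]; push_cast; ring_nf,
      show ((c * c' : ℕ) : ZMod p) • red p y = (c : ZMod p) • ((c' : ZMod p) • red p y) by
        rw [smul_smul]; push_cast; ring_nf,
      smul_red_of_rep hc hcx, smul_red_of_rep hc' hcy]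
    ext
    · simp only [re_add, re_smul, smul_eq_mul]; push_cast; ring
    · simp only [im_add, im_smul, smul_eq_mul]; push_cast; ring
  rw [← h2] at h1
  exact smul_right_injective (F p) (natCast_zmod_ne_zero hcc) h1

/-- **`red x = 0` when `val x < 1`.** [folklore] -/
theorem red_eq_zero_of_val_lt_one {x : K3} (hx : val hp x < 1) : red p x = 0 := by
  obtain ⟨c, a, b, hc, hcx⟩ := exists_rep_of_val_le_one hp hx.le
  have hy : val hp ((mkInt a b : 𝓞 K3) : K3) < 1 := by
    rw [coe_mkInt, ← hcx, Valuation.map_mul, val_natCast_of_not_dvd hp hc, one_mul]; exact hx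
  rw [val_coe_lt_one_iff, natCast_dvd_mkInt_iff p] at hy
  have h1 := smul_red_of_rep (p := p) hc hcx
  rw [(ZMod.intCast_zmod_eq_zero_iff_dvd a p).mpr hy.1,
    (ZMod.intCast_zmod_eq_zero_iff_dvd b p).mpr hy.2] at h1
  have h0 : (c : ZMod p) • red p x = 0 := by rw [h1]; rfl
  exact (smul_eq_zero.mp h0).resolve_left (natCast_zmod_ne_zero hc)

/-- **`red x ≠ 0` when `val x = 1`.** [folklore] -/
theorem red_ne_zero_of_val_eq_one {x : K3} (hx : val hp x = 1) : red p x ≠ 0 := by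
  obtain ⟨c, a, b, hc, hcx⟩ := exists_rep_of_val_le_one hp hx.le
  have hy : val hp ((mkInt a b : 𝓞 K3) : K3) = 1 := by
    rw [coe_mkInt, ← hcx, Valuation.map_mul, val_natCast_of_not_dvd hp hc, one_mul]; exact hx
  rw [val_coe_eq_one_iff, natCast_dvd_mkInt_iff p] at hy
  intro h0
  have h1 := smul_red_of_rep (p := p) hc hcx
  rw [h0, smul_zero] at h1
  have hre := congrArg QuadraticAlgebra.re h1
  have him := congrArg QuadraticAlgebra.im h1
  simp only [re_zero, im_zero] at hre him
  exact hy ⟨(ZMod.intCast_zmod_eq_zero_iff_dvd a p).mp hre.symm,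
    (ZMod.intCast_zmod_eq_zero_iff_dvd b p).mp him.symm⟩

/-- `red` of an element with vanishing `ζ`-coordinate. [folklore] -/
theorem red_of_im_eq_zero {x : K3} (h : x.im = 0) : red p x = ⟨(x.re : ZMod p), 0⟩ := by
  rw [red, h, Rat.cast_zero]

/-- `red ζ = ω`. [folklore] -/
theorem red_zeta : red p zeta = ω := by
  rw [red, zeta_re, zeta_im, Rat.cast_zero, Rat.cast_one]; rfl

/-! ### Unit parts and the cubic residue character of the unit part -/

/-- **The unit part** `x · p^{log val x}` of `x` at `p` (a `val`-unit for `x ≠ 0`). [folklore] -/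
def unitPart (x : K3) : K3 := x * (p : K3) ^ (log (val hp x))

omit hpp in
/-- `val (unitPart x) = 1` (`x ≠ 0`). [folklore] -/
theorem val_unitPart {x : K3} (hx : x ≠ 0) : val hp (unitPart hp x) = 1 := by
  have hvx : val hp x ≠ 0 := (Valuation.ne_zero_iff _).mpr hx
  rw [unitPart, Valuation.map_mul, map_zpow₀, val_natCast_self, ← WithZero.exp_zsmul, smul_neg,
    zsmul_eq_mul, mul_one, Int.cast_id]
  nth_rewrite 1 [← WithZero.exp_log hvx]
  rw [← WithZero.exp_add, add_neg_cancel, WithZero.exp_zero]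

/-- `unitPart (x y) = unitPart x · unitPart y` (`x, y ≠ 0`). [folklore] -/
theorem unitPart_mul {x y : K3} (hx : x ≠ 0) (hy : y ≠ 0) :
    unitPart hp (x * y) = unitPart hp x * unitPart hp y := by
  rw [unitPart, unitPart, unitPart, Valuation.map_mul,
    WithZero.log_mul ((Valuation.ne_zero_iff _).mpr hx) ((Valuation.ne_zero_iff _).mpr hy),
    zpow_add₀ (natCast_ne_zero (p := p))]
  ring

omit hpp in
/-- **The cubic residue character on `𝔽_p[ω]`**: the discrete logarithm (base `ω̄`) of
`z^{(p² − 1)/3} ∈ {1, ω̄, ω̄²}` (`p ≡ 2 (mod 3)`), and `0` off `{ω̄, ω̄²}`.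
[cite: IrelandRosen1990, Ch. 9 §3] -/
def cubicChar (z : F p) : ZMod 3 :=
  if z ^ ((p ^ 2 - 1) / 3) = ω then 1 else if z ^ ((p ^ 2 - 1) / 3) = ω * ω then 2 else 0

/-- **The cubic residue character of the unit part** `χ_p(x) = χ̄(red(unitPart x))`.
[cite: IrelandRosen1990, Ch. 9 §3] -/
def chi (x : K3) : ZMod 3 := cubicChar (red p (unitPart hp x))

/-- **`χ_p` is multiplicative on `K3ˣ`**, granted the multiplicativity of `χ̄` on `𝔽_p[ω] ∖ {0}`
(a finite check). [cite: IrelandRosen1990, Prop. 9.3.3] -/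
theorem chi_mul (Hmul : ∀ z w : F p, z ≠ 0 → w ≠ 0 → cubicChar (z * w) = cubicChar z + cubicChar w)
    {x y : K3} (hx : x ≠ 0) (hy : y ≠ 0) : chi hp (x * y) = chi hp x + chi hp y := by
  rw [chi, chi, chi, unitPart_mul hp hx hy, red_mul hp (val_unitPart hp hx).le (val_unitPart hp hy).le]
  exact Hmul _ _ (red_ne_zero_of_val_eq_one hp (val_unitPart hp hx))
    (red_ne_zero_of_val_eq_one hp (val_unitPart hp hy))

/-- **`χ_p` depends only on the leading digit**: `val (y − x) < val x ⟹ χ_p y = χ_p x`.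
[cite: IrelandRosen1990, Ch. 9 §3] -/
theorem chi_eq_of_val_sub_lt {x y : K3} (h : val hp (y - x) < val hp x) : chi hp y = chi hp x := by
  have hx : x ≠ 0 := fun h0 ↦ by rw [h0, Valuation.map_zero] at h; exact not_lt_zero h
  have hy : y ≠ 0 := fun h0 ↦ by
    rw [h0, zero_sub, Valuation.map_neg] at h; exact lt_irrefl _ h
  have hval : val hp y = val hp x := Valuation.map_eq_of_sub_lt _ h
  set L := log (val hp x) with hL
  have hux : unitPart hp x = x * (p : K3) ^ L := rfl
  have huy : unitPart hp y = y * (p : K3) ^ L := by rw [unitPart, hval]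
  -- the difference of the unit parts has `val < 1`
  set d := (y - x) * (p : K3) ^ L with hd
  have hdval : val hp d < 1 := by
    have hpL : val hp ((p : K3) ^ L) ≠ 0 :=
      (Valuation.ne_zero_iff _).mpr (zpow_ne_zero L (natCast_ne_zero (p := p)))
    calc val hp d = val hp (y - x) * val hp ((p : K3) ^ L) := Valuation.map_mul _ _ _
      _ < val hp x * val hp ((p : K3) ^ L) := mul_lt_mul_of_pos_right h (zero_lt_iff.mpr hpL)
      _ = val hp (unitPart hp x) := (Valuation.map_mul _ _ _).symm
      _ = 1 := val_unitPart hp hx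
  have hsum : unitPart hp y = unitPart hp x + d := by rw [huy, hux, hd]; ring
  rw [chi, chi, hsum, red_add hp (val_unitPart hp hx).le hdval.le, red_eq_zero_of_val_lt_one hp hdval,
    add_zero]

omit hpp in
/-- The unit part of a rational element is rational (vanishing `ζ`-coordinate). [folklore] -/
theorem im_unitPart_of_im_eq_zero {x : K3} (h : x.im = 0) : (unitPart hp x).im = 0 := by
  have hp' : ((p : K3) ^ (log (val hp x))).im = 0 := by
    rw [show (p : K3) = ((p : ℚ) : K3) by push_cast; rfl, ← Rat.cast_zpow]
    rfl
  rw [unitPart, im_mul, h, hp']; ring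

/-- **`χ_p` kills `ℚˣ`** (indeed all elements with vanishing `ζ`-coordinate), granted
`χ̄(𝔽_p) = 0` (a finite check: `𝔽_pˣ ⊆ (𝔽_{p²}ˣ)³` for `p ≡ 2 (mod 3)`). [cite: IrelandRosen1990, Ch. 9 §3] -/
theorem chi_of_im_eq_zero (Hrat : ∀ c : ZMod p, cubicChar (⟨c, 0⟩ : F p) = 0) {x : K3}
    (h : x.im = 0) : chi hp x = 0 := by
  rw [chi, red_of_im_eq_zero (im_unitPart_of_im_eq_zero hp h)]; exact Hrat _

/-- `χ_p(q) = 0` for `q ∈ ℚ`. [folklore] -/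
theorem chi_ratCast (Hrat : ∀ c : ZMod p, cubicChar (⟨c, 0⟩ : F p) = 0) (q : ℚ) :
    chi hp (q : K3) = 0 := chi_of_im_eq_zero hp Hrat rfl

/-- `χ_p(n) = 0` for `n ∈ ℕ`. [folklore] -/
theorem chi_natCast (Hrat : ∀ c : ZMod p, cubicChar (⟨c, 0⟩ : F p) = 0) (n : ℕ) :
    chi hp (n : K3) = 0 := chi_of_im_eq_zero hp Hrat rfl

/-- `χ_p(−1) = 0`. [folklore] -/
theorem chi_neg_one (Hrat : ∀ c : ZMod p, cubicChar (⟨c, 0⟩ : F p) = 0) : chi hp (-1) = 0 :=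
  chi_of_im_eq_zero hp Hrat rfl

/-- `χ_p(s) = 0` for `s ∈ ℤ`. [folklore] -/
theorem chi_intCast (Hrat : ∀ c : ZMod p, cubicChar (⟨c, 0⟩ : F p) = 0) (s : ℤ) :
    chi hp (s : K3) = 0 := chi_of_im_eq_zero hp Hrat rfl

/-- **`χ_p(ζ) = χ̄(ω̄)`.** [folklore] -/
theorem chi_zeta : chi hp zeta = cubicChar (ω : F p) := by
  rw [chi, unitPart, log_val_zeta, zpow_zero, mul_one, red_zeta]

/-- `χ_p(1) = 0`. [folklore] -/
theorem chi_one (Hmul : ∀ z w : F p, z ≠ 0 → w ≠ 0 → cubicChar (z * w) = cubicChar z + cubicChar w) :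
    chi hp 1 = 0 := by
  have h := chi_mul hp Hmul one_ne_zero one_ne_zero
  rw [mul_one] at h
  have h3 : ∀ a : ZMod 3, a = a + a → a = 0 := by decide
  exact h3 _ h

/-- `χ_p(xⁿ) = n χ_p(x)`. [folklore] -/
theorem chi_pow (Hmul : ∀ z w : F p, z ≠ 0 → w ≠ 0 → cubicChar (z * w) = cubicChar z + cubicChar w)
    {x : K3} (hx : x ≠ 0) (n : ℕ) : chi hp (x ^ n) = n * chi hp x := by
  induction n with
  | zero => rw [pow_zero, Nat.cast_zero, zero_mul]; exact chi_one hp Hmul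
  | succ n ih => rw [pow_succ, chi_mul hp Hmul (pow_ne_zero n hx) hx, ih]; push_cast; ring

/-- `χ_p(w³) = 0`. [folklore] -/
theorem chi_pow_three (Hmul : ∀ z w : F p, z ≠ 0 → w ≠ 0 → cubicChar (z * w) = cubicChar z + cubicChar w)
    {x : K3} (hx : x ≠ 0) : chi hp (x ^ 3) = 0 := by
  rw [chi_pow hp Hmul hx 3]
  have h3 : ∀ a : ZMod 3, (3 : ℕ) * a = 0 := by decide
  exact h3 _

/-- `val (ζ − 1) = 1` at an inert rational prime (`p ∤ λ`). [folklore] -/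
theorem val_zeta_sub_one : val hp (zeta - 1) = 1 := by
  rw [← coe_lamInt, val_coe_eq_one_iff, lamInt_eq, natCast_dvd_mkInt_iff p]
  rintro ⟨-, h1⟩
  exact hpp.out.ne_one (by exact_mod_cast Int.eq_one_of_dvd_one (by positivity) h1)

/-- `log val (ζ − 1) = 0` at an inert rational prime. [folklore] -/
theorem log_val_zeta_sub_one : log (val hp (zeta - 1)) = 0 := by
  rw [val_zeta_sub_one, WithZero.log_one]

end Inert

/-! ### The prime `2`: `𝔽₄` and `χ₂` -/

section Two

/-- `2` is prime in `𝓞 K3` (cast from `ℕ`). [cite: IrelandRosen1990, Prop. 9.1.4] -/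
theorem prime_natCast_two : Prime ((2 : ℕ) : 𝓞 K3) := by simpa using prime_two

/-- `χ̄` is multiplicative on `𝔽₄ˣ` (finite check). [cite: IrelandRosen1990, Prop. 9.3.3] -/
theorem cubicChar_mul_two :
    ∀ z w : F 2, z ≠ 0 → w ≠ 0 → cubicChar (z * w) = cubicChar z + cubicChar w := by decide

/-- `χ̄(𝔽₂) = 0` (finite check). [cite: IrelandRosen1990, Ch. 9 §3] -/
theorem cubicChar_ratCast_two : ∀ c : ZMod 2, cubicChar (⟨c, 0⟩ : F 2) = 0 := by decide

/-- `χ̄(ω̄) = 1` in `𝔽₄` (`(4 − 1)/3 = 1`). [cite: IrelandRosen1990, Ch. 9 §3] -/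
theorem cubicChar_omega_two : cubicChar (ω : F 2) = 1 := by decide

/-- **The cubic residue character of the `2`-unit part**, `χ₂ : K3 → ℤ/3ℤ`.
[cite: IrelandRosen1990, Ch. 9 §3] -/
abbrev chi2 : K3 → ZMod 3 := chi prime_natCast_two

/-- `χ₂(ζ) = 1`. [folklore] -/
theorem chi2_zeta : chi2 zeta = 1 := (chi_zeta _).trans cubicChar_omega_two

end Two

/-! ### The prime `5`: `𝔽₂₅` and `χ₅` -/

section Five

/-- `5` is prime (as a `Fact`, for `ZMod 5`). [folklore] -/
instance fact_prime_five : Fact (Nat.Prime 5) := ⟨by decide⟩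

/-- `5` is prime in `𝓞 K3` (cast from `ℕ`). [cite: IrelandRosen1990, Prop. 9.1.4] -/
theorem prime_natCast_five : Prime ((5 : ℕ) : 𝓞 K3) := by simpa using prime_five

set_option maxRecDepth 4000 in
/-- `χ̄` is multiplicative on `𝔽₂₅ˣ` (finite check). [cite: IrelandRosen1990, Prop. 9.3.3] -/
theorem cubicChar_mul_five :
    ∀ z w : F 5, z ≠ 0 → w ≠ 0 → cubicChar (z * w) = cubicChar z + cubicChar w := by
  decide +kernel

/-- `χ̄(𝔽₅) = 0` (finite check). [cite: IrelandRosen1990, Ch. 9 §3] -/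
theorem cubicChar_ratCast_five : ∀ c : ZMod 5, cubicChar (⟨c, 0⟩ : F 5) = 0 := by decide +kernel

/-- `χ̄(ω̄) = 2` in `𝔽₂₅` (`ω̄⁸ = ω̄²`). [cite: IrelandRosen1990, Ch. 9 §3] -/
theorem cubicChar_omega_five : cubicChar (ω : F 5) = 2 := by decide +kernel

/-- **The cubic residue character of the `5`-unit part**, `χ₅ : K3 → ℤ/3ℤ`.
[cite: IrelandRosen1990, Ch. 9 §3] -/
abbrev chi5 : K3 → ZMod 3 := chi prime_natCast_five

/-- `χ₅(ζ) = 2`. [folklore] -/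
theorem chi5_zeta : chi5 zeta = 2 := (chi_zeta _).trans cubicChar_omega_five

end Five

/-! ### The prime `λ = ζ − 1`: valuations of `2`, `5`, `ζ` -/

section Lam

/-- `val_λ n = 1` for a natural `n` prime to `3`. [folklore] -/
theorem val_lam_natCast {n : ℕ} (hn : ¬ 3 ∣ n) : val prime_lamInt (n : K3) = 1 := by
  have h : (n : K3) = (((n : ℤ) : 𝓞 K3) : K3) := by push_cast; rfl
  rw [h, val_coe_eq_one_iff, lamInt_dvd_intCast_iff]
  exact_mod_cast hn

/-- `log val_λ n = 0` for a natural `n` prime to `3`. [folklore] -/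
theorem log_val_lam_natCast {n : ℕ} (hn : ¬ 3 ∣ n) : log (val prime_lamInt (n : K3)) = 0 := by
  rw [val_lam_natCast hn, WithZero.log_one]

/-- `log val_λ (ζ − 1) = −1`. [folklore] -/
theorem log_val_lam_zeta_sub_one : log (val prime_lamInt (zeta - 1)) = -1 := by
  rw [← coe_lamInt]; exact log_val_self prime_lamInt

end Lam

end K3

end Literature.NumberTheory.NumberFields

end
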